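import Mathlib
import Literature.Computability.Complexity.ExtMonotoneCircuits
import Literature.Computability.Complexity.MonotoneSwitching
import Literature.Computability.Complexity.CliqueTestGraphs
import Literature.Computability.Complexity.RossmanMonotoneCliqueProb
import Summits.PneNP.PneNP.Theses.ConvexRankGates
import Summits.PneNP.PneNP.Theorems.CliqueExtLowerBound.Negative.LoadBearing
import Summits.PneNP.PneNP.Theorems.CliqueExtLowerBound.Negative.PermConsequences

/-!
# Skeleton line `event-sandwich-interpolation` for crux `CliqueExtLowerBound` (stmt-PneNP-10682)

Route `PneNP/ConvexRankGates`; crux decl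
`Summit.PneNP.PneNP.Theses.ConvexRankGates.CliqueExtLowerBound`
(`∃ δ ∈ (0,1/2), ∀ c, ∀ᶠ m, no circuit with ≤ m^c gates over B_{m^c} = {∧₂,∨₂} ∪ CONV ∪ PERM ∪ GRANK
computes CLIQUE(m, ⌈m^δ⌉₊)`); idea card `Cruxes/CliqueExtLowerBound/Ideas/event-sandwich-interpolation.md`
(ideator 2, triage r1: pass ×3).

THE LINE. Run Jukna's two-sided CNF/DNF approximation along a `B_{m^c}`-circuit, but charge the two
correcting objects as EVENTS to the referee measures — positives `1_K`, `K` a uniform `k`-subset of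
`Fin m` (`k = ⌈m^δ⌉₊`); negatives `K_m ∖ E`, `E ~ G(m, γ)`, `γ = 4 ln m / k`. Every wire carries an
`r`-local DNF (monomials touch `< r` vertices) below an `s`-local CNF (clauses have `< s` edges); a
monotone gate `φ` of ANY class and ANY fan-in is passed using only its monotonicity, at the price of the
single-gate interpolation property `GateInterpolates φ …` (ICL): for every tuple of children pairs there is
an `r`-local DNF `A ≤` an `s`-local CNF `B` losing at most an `ε = m^{-c-2}` fraction of the positives
accepted by `φ(children DNFs)` and at most `ε` of the negatives rejected by `φ(children CNFs)`. With
`≤ m^c` gates the two event budgets total `m^{-2}`; at the output, `A_out ≤ B_out` pits "every `k`-set is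
charged" against "a nonempty local DNF forces its CNF to be alive on `K_m ∖ E` while `K_m ∖ E` is
`k`-clique-free" — contradiction for large `m` (`stub_sandwichReduction`, provable now). So the crux
reduces to ICL with CONSTANT localities `r, s = O_δ(c)` for the gate classes of the basis:
`∧₂/∨₂` (`stub_andOrInterpolate`, the tree's switching lemma in this currency — provable now and the
calibration of the currency), CONV (`stub_convInterpolates`, hardest), PERM (`stub_permInterpolates`),
GRANK (`stub_grankInterpolates`). `CliqueExtLowerBound_of` composes them (δ := 1/4; thresholds
`∀ r ≥ r₀, ∀ s ≥ s₀` make the per-class lemmas share one locality; bridge to the inline route text by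
`Negative.cliqueExtLowerBound_iff`).

DISPROOF USED (Cruxes/CliqueExtLowerBound/Disproof.lean gen 2 + landed `Theorems/…/Negative/*`):
§0 `cliqueExtLowerBound_iff`/`LowerBoundAt` (imported, used in `_of`); §1 `not_lowerBoundAt_delta_zero`
/ `_delta_one` (`0 < δ` is used by the reduction: `k → ∞` drives `γ → 0` and `Pr[K_m∖E ⊇ k-clique] → 0`;
`δ < 1` is used by `stub_andOrInterpolate`: the `∧`-side error `(k/m)^{Ω(√r)}` needs `k/m → 0`, and ICL(∧₂)
is FALSE at `δ = 1`); §3 size bound (the union bound is over `≤ m^c` gates); §2/§7.4 width/dimension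
bounds (ICL is asked only of gates of parameter `≤ m^c`; by §7 `exists_onePermGate_extGate_computes` ICL for
PERM gates of width `permWidth m k = 2(1 + C(m,k)·#E)` would contradict the reduction, so
`stub_permInterpolates` genuinely spends `d ≤ m^c`); §5 (every gate asked is monotone — ICL(¬) is false);
§8 `exists_convData_uncertified_rejection` (ICL(CONV) is stated for the gate FUNCTION, realisation-free, so
certificate-based proofs must first re-realise; noted on the card). No stub is an instance of a landed
Negative lemma (all imported here and co-elaborated).

Conventions: `sorry` appears ONLY inside the five `stub_*` theorems; `CliqueExtLowerBound_of` is a real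
proof whose conclusion is literally the route decl (hypotheses = the name-keyed aliases `Registered.stub_*` of the
five statements); `CliqueExtLowerBound_closed` is the same composition fed with the stubs; three sanity lemmas
(constants, identity) are proved and fix the polarity of `GateInterpolates`.
-/

set_option linter.unusedVariables false
set_option linter.dupNamespace false
set_option linter.unusedSimpArgs false

namespace Summit.PneNP.PneNP.Cruxes.CliqueExtLowerBound.EventSandwichInterpolation

open scoped BigOperators Classical
open Finset Filter Literature.Computability.Complexity
open Summit.PneNP.PneNP.Theorems.CliqueExtLowerBound.Negative (LowerBoundAt cliqueExtLowerBound_iff)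

noncomputable section

/-! ### Definitions: localities, children pairs, the per-gate interpolation property (ICL) -/

/-- Edge variables of `K_m` (the input type of the crux's circuits). -/
abbrev Edge (m : ℕ) : Type := (⊤ : SimpleGraph (Fin m)).edgeSet

/-- A monomial (set of edges) touches fewer than `r` vertices (Jukna 2012 §9.7, legal length measure:
monomials are measured by touched vertices, clauses by edges). [folklore] -/
def TouchesLT {m : ℕ} (r : ℕ) (R : Finset (Edge m)) : Prop :=
  ∃ T : Finset (Fin m), T.card < r ∧ ∀ e ∈ R, ∀ v ∈ (e : Sym2 (Fin m)), v ∈ T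

/-- The negative test input `K_m ∖ E`, as a function of the missing-edge indicator `y = 1_E`. -/
def coGraph {m : ℕ} (y : Edge m → Bool) : Edge m → Bool := fun e => !(y e)

/-- Children data handed to a gate of fan-in `n` by the sandwich induction: per child an `r`-local DNF
below an `s`-local CNF (`dnf ≤ cnf` pointwise, as in the tree's `ApproxInv.dnf_le_cnf`). -/
structure ChildApprox (m n r s : ℕ) where
  /-- lower-locality side: monomial families -/
  dnf : Fin n → Finset (Finset (Edge m))
  /-- clause families -/
  cnf : Fin n → Finset (Finset (Edge m))
  width_dnf : ∀ i, ∀ R ∈ dnf i, TouchesLT r R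
  width_cnf : ∀ i, ∀ S ∈ cnf i, S.card < s
  dnf_le_cnf : ∀ i x, EvalDNF (dnf i) x → EvalCNF (cnf i) x

/-- `Φ_D = φ(children's DNFs)` — on positives off the charged events it dominates the true wire value. -/
def lowerVal {m r s : ℕ} (g : GateFn) (ch : ChildApprox m g.1 r s) (x : Edge m → Bool) : Bool :=
  g.2 fun i => decide (EvalDNF (ch.dnf i) x)

/-- `Φ_C = φ(children's CNFs)` — on negatives off the charged events it is dominated by the true value. -/
def upperVal {m r s : ℕ} (g : GateFn) (ch : ChildApprox m g.1 r s) (x : Edge m → Bool) : Bool :=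
  g.2 fun i => decide (EvalCNF (ch.cnf i) x)

/-- **ICL — the per-gate interpolation property on the referee pair.** For every tuple of children
pairs there are an `r`-local DNF `A ≤` an `s`-local CNF `B` such that
(P) at most `ε·C(m,k)` of the `k`-sets `K` have `Φ_D(1_K) = 1` but `A(1_K) = 0`, and
(N) with probability `≤ ε` over `E ~ G(m, γ)`: `Φ_C(K_m ∖ E) = 0` but `B(K_m ∖ E) = 1`.
These are exactly the two event-valued corrections of the sandwich induction. Trivial iff
`min(Pr_K[Φ_D = 1], Pr_E[Φ_C = 0]) ≤ ε` (take `(A,B) = (∅,{∅})` or `({∅},∅)`); if `A ≠ ∅` then every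
clause of `B` meets the `< r²/2` edges of one monomial, so `Pr_E[B = 0] < r²γ/2` — hence for gates whose
CNF-side rejects `> ε + r²γ/2` of the negatives ICL says exactly `Pr_K[Φ_D = 1] ≤ ε` (non-distinguisher
form, triage r1-2). Working form: ICL ⟺ ∃ family 𝒜 of `(<r)`-vertex sets with
`Pr_K[Φ_D(1_K)=1 ∧ K ⊉ every U ∈ 𝒜] ≤ ε` and `Pr_E[Φ_C(K_m∖E)=0 ∧ E ⊉ every (<s)-edge set meeting all
E(U), U ∈ 𝒜] ≤ ε` (WLOG monomials are full cliques `E(U)` and `B` is the family of ALL short clauses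
meeting all monomials). [folklore] -/
def GateInterpolates (g : GateFn) (m k r s : ℕ) (γ ε : ℝ) : Prop :=
  ∀ ch : ChildApprox m g.1 r s,
    ∃ A B : Finset (Finset (Edge m)),
      (∀ R ∈ A, TouchesLT r R) ∧ (∀ S ∈ B, S.card < s) ∧
      (∀ x, EvalDNF A x → EvalCNF B x) ∧
      (((univ : Finset (Finset (Fin m))).filter fun K => K.card = k ∧
            lowerVal g ch (cliqueVec K) = true ∧ ¬ EvalDNF A (cliqueVec K)).card : ℝ)
          ≤ ε * (m.choose k : ℝ) ∧
      prob γ (fun y : Edge m → Bool =>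
          upperVal g ch (coGraph y) = false ∧ EvalCNF B (coGraph y)) ≤ ε

/-- Missing-edge density of the referee negatives: `γ = 4 ln m / k`, `k = ⌈m^δ⌉₊` (so that
`E #k-cliques(K_m ∖ E) ≤ C(m,k) e^{-γ C(k,2)} ≤ m^{2-k} → 0`). -/
def gammaOf (δ : ℝ) (m : ℕ) : ℝ := 4 * Real.log m / (⌈(m : ℝ) ^ δ⌉₊ : ℝ)

/-! ### Sanity lemmas (proved): constants and the identity gate interpolate with zero error

These fix the polarity of (P)/(N): `(A,B) = ({∅},∅)` for constant `true`, `(∅,{∅})` for constant `false`, and the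
child's own pair for a projection — the base cases every stub proof starts from. -/

/-- **Sanity 1** (polarity check of `GateInterpolates`, proved): the constant-`true` gate interpolates with zero error via `(A,B) = ({∅}, ∅)` (needs `1 ≤ r`). -/
theorem gateInterpolates_const_true (m k r s : ℕ) (hr : 0 < r) {γ ε : ℝ} (hε : 0 ≤ ε) :
    GateInterpolates (GateFn.const true) m k r s γ ε := by
  intro ch
  refine ⟨{∅}, ∅, ?_, ?_, ?_, ?_, ?_⟩
  · intro R hR
    rw [Finset.mem_singleton] at hR
    subst hR
    exact ⟨∅, by simpa using hr, by simp⟩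
  · intro S hS; simp at hS
  · intro x _; exact evalCNF_empty
  · have h0 : ((univ : Finset (Finset (Fin m))).filter fun K => K.card = k ∧
        lowerVal (GateFn.const true) ch (cliqueVec K) = true ∧
          ¬ EvalDNF ({∅} : Finset (Finset (Edge m))) (cliqueVec K)) = ∅ := by
      refine Finset.filter_eq_empty_iff.2 fun K _ h => h.2.2 evalDNF_singleton_empty
    rw [h0, Finset.card_empty, Nat.cast_zero]
    positivity
  · have : prob γ (fun y : Edge m → Bool =>
        upperVal (GateFn.const true) ch (coGraph y) = false ∧ EvalCNF (∅ : Finset (Finset (Edge m))) (coGraph y))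
        = prob γ (fun _ : Edge m → Bool => False) := by
      refine prob_congr fun y => ?_
      simp [upperVal, GateFn.const]
    rw [this, prob_false]
    exact hε

/-- **Sanity 2** (proved): the constant-`false` gate interpolates with zero error via `(A,B) = (∅, {∅})` (needs `1 ≤ s`). -/
theorem gateInterpolates_const_false (m k r s : ℕ) (hs : 0 < s) {γ ε : ℝ} (hε : 0 ≤ ε) :
    GateInterpolates (GateFn.const false) m k r s γ ε := by
  intro ch
  refine ⟨∅, {∅}, ?_, ?_, ?_, ?_, ?_⟩
  · intro R hR; simp at hR
  · intro S hS
    rw [Finset.mem_singleton] at hS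
    subst hS
    simpa using hs
  · intro x hx; exact absurd hx not_evalDNF_empty
  · have h0 : ((univ : Finset (Finset (Fin m))).filter fun K => K.card = k ∧
        lowerVal (GateFn.const false) ch (cliqueVec K) = true ∧
          ¬ EvalDNF (∅ : Finset (Finset (Edge m))) (cliqueVec K)) = ∅ := by
      refine Finset.filter_eq_empty_iff.2 fun K _ h => ?_
      have := h.2.1
      simp [lowerVal, GateFn.const] at this
    rw [h0, Finset.card_empty, Nat.cast_zero]
    positivity
  · have : prob γ (fun y : Edge m → Bool =>
        upperVal (GateFn.const false) ch (coGraph y) = false ∧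
          EvalCNF ({∅} : Finset (Finset (Edge m))) (coGraph y))
        = prob γ (fun _ : Edge m → Bool => False) := by
      refine prob_congr fun y => ?_
      simp only [iff_false, not_and]
      intro _ h
      exact not_evalCNF_singleton_empty h
    rw [this, prob_false]
    exact hε

/-- **Sanity 3** (proved): the identity gate passes its child's pair through with zero error (`A = dnf₀`, `B = cnf₀`). -/
theorem gateInterpolates_id (m k r s : ℕ) {γ ε : ℝ} (hε : 0 ≤ ε) :
    GateInterpolates GateFn.id m k r s γ ε := by
  intro ch
  let i0 : Fin GateFn.id.1 := ⟨0, by decide⟩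
  refine ⟨ch.dnf i0, ch.cnf i0, ch.width_dnf i0, ch.width_cnf i0, ch.dnf_le_cnf i0, ?_, ?_⟩
  · have h0 : ((univ : Finset (Finset (Fin m))).filter fun K => K.card = k ∧
        lowerVal GateFn.id ch (cliqueVec K) = true ∧ ¬ EvalDNF (ch.dnf i0) (cliqueVec K)) = ∅ := by
      refine Finset.filter_eq_empty_iff.2 fun K _ h => ?_
      have h1 := h.2.1
      simp only [lowerVal, GateFn.id, decide_eq_true_eq] at h1
      exact h.2.2 h1
    rw [h0, Finset.card_empty, Nat.cast_zero]
    positivity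
  · have : prob γ (fun y : Edge m → Bool =>
        upperVal GateFn.id ch (coGraph y) = false ∧ EvalCNF (ch.cnf i0) (coGraph y))
        = prob γ (fun _ : Edge m → Bool => False) := by
      refine prob_congr fun y => ?_
      simp only [upperVal, GateFn.id, decide_eq_false_iff_not, iff_false, not_and]
      intro h1 h2
      exact h1 h2
    rw [this, prob_false]
    exact hε

/-! ### The five stub STATEMENTS (named `Prop`s; the registered `stub_*` theorems below restate them verbatim,
and `Registered.stub_*` are the name-keyed aliases used as the hypotheses of `CliqueExtLowerBound_of`) -/

/-- Statement of STUB 1 (the host): per-gate interpolation at constant locality ⇒ the schedule form of the crux,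
for every `δ ∈ (0,1)`. [folklore] -/
def SandwichReduction : Prop :=
  ∀ δ : ℝ, 0 < δ → δ < 1 →
      (∀ c : ℕ, ∃ r s : ℕ, 3 ≤ r ∧ 2 ≤ s ∧ ∀ᶠ m : ℕ in atTop, ∀ g ∈ extGate (m ^ c),
          GateInterpolates g m ⌈(m : ℝ) ^ δ⌉₊ r s (gammaOf δ m) ((m : ℝ) ^ (-(c : ℝ) - 2))) →
      LowerBoundAt (fun m => ⌈(m : ℝ) ^ δ⌉₊)

/-- Statement of STUB 2: ICL for `∧₂`, `∨₂` (the calibration of the currency), `δ ∈ (0,1)`. [folklore] -/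
def AndOrInterpolate : Prop :=
  ∀ δ : ℝ, 0 < δ → δ < 1 → ∀ c : ℕ, ∃ r₀ s₀ : ℕ, ∀ r s : ℕ, r₀ ≤ r → s₀ ≤ s →
      ∀ᶠ m : ℕ in atTop, ∀ g : GateFn, (g = GateFn.and 2 ∨ g = GateFn.or 2) →
        GateInterpolates g m ⌈(m : ℝ) ^ δ⌉₊ r s (gammaOf δ m) ((m : ℝ) ^ (-(c : ℝ) - 2))

/-- Statement of STUB 3: ICL for CONV gates of parameter `≤ m^c`, `δ ∈ (0,1/2)`. [folklore] -/
def ConvInterpolates : Prop :=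
  ∀ δ : ℝ, 0 < δ → δ < 1 / 2 → ∀ c : ℕ, ∃ r₀ s₀ : ℕ, ∀ r s : ℕ, r₀ ≤ r → s₀ ≤ s →
      ∀ᶠ m : ℕ in atTop, ∀ g : GateFn, IsConvGate (m ^ c) g →
        GateInterpolates g m ⌈(m : ℝ) ^ δ⌉₊ r s (gammaOf δ m) ((m : ℝ) ^ (-(c : ℝ) - 2))

/-- Statement of STUB 4: ICL for PERM gates on `≤ m^c` points, `δ ∈ (0,1/2)`. [folklore] -/
def PermInterpolates : Prop :=
  ∀ δ : ℝ, 0 < δ → δ < 1 / 2 → ∀ c : ℕ, ∃ r₀ s₀ : ℕ, ∀ r s : ℕ, r₀ ≤ r → s₀ ≤ s →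
      ∀ᶠ m : ℕ in atTop, ∀ g : GateFn, IsPermGate (m ^ c) g →
        GateInterpolates g m ⌈(m : ℝ) ^ δ⌉₊ r s (gammaOf δ m) ((m : ℝ) ^ (-(c : ℝ) - 2))

/-- Statement of STUB 5: ICL for GRANK gates of dimension `≤ m^c`, `δ ∈ (0,1/2)`. [folklore] -/
def GRankInterpolates : Prop :=
  ∀ δ : ℝ, 0 < δ → δ < 1 / 2 → ∀ c : ℕ, ∃ r₀ s₀ : ℕ, ∀ r s : ℕ, r₀ ≤ r → s₀ ≤ s →
      ∀ᶠ m : ℕ in atTop, ∀ g : GateFn, IsGRankGate (m ^ c) g →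
        GateInterpolates g m ⌈(m : ℝ) ^ δ⌉₊ r s (gammaOf δ m) ((m : ℝ) ^ (-(c : ℝ) - 2))

/-! ### The five registered stubs (`sorry` lives ONLY in these five theorems) -/

/-- **Stub 1 — sandwich reduction (the host; provable now, M-sized).** For `δ ∈ (0,1)`: if for every
exponent `c` some CONSTANT localities `r ≥ 3`, `s ≥ 2` make every gate of `B_{m^c}` interpolate with
error `m^{-c-2}` for all large `m`, then no `B_{m^c}`-circuit with `≤ m^c` gates computes
`CLIQUE(m, ⌈m^δ⌉₊)` for large `m` (`Negative.LowerBoundAt`, the schedule form of the crux).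
Proof plan: event form of `GateList.exists_approximators` (induction along the program; input wire `e` gets
the exact pair `({{e}},{{e}})`, legal since `r ≥ 3`, `s ≥ 2`; at a gate, monotonicity gives `g ≤ Φ_D` on
uncharged positives and `Φ_C ≤ g` on uncharged negatives, ICL gives the new pair and two new events of
mass `≤ ε` each), then the endgame: total charged mass `≤ m^c·m^{-c-2} = m^{-2}` on each side; if
`A_out = ∅` every `k`-set is charged (`C(m,k) ≤ m^{-2} C(m,k)`, absurd); else a monomial `R` of `A_out`
(`< r²/2` edges) meets every clause of `B_out`, so `Pr_E[B_out(K_m∖E) = 0] ≤ r²γ/2 → 0`, while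
`B_out ≤ CLIQUE` off the charged negatives and `Pr_E[K_m∖E ⊇ k-clique] ≤ m^{2-k} → 0` — absurd for
large `m`. Uses `0 < δ` (k → ∞) — cf. Disproof §1 `not_lowerBoundAt_delta_zero`. -/
theorem stub_sandwichReduction :
    ∀ δ : ℝ, 0 < δ → δ < 1 →
      (∀ c : ℕ, ∃ r s : ℕ, 3 ≤ r ∧ 2 ≤ s ∧ ∀ᶠ m : ℕ in atTop, ∀ g ∈ extGate (m ^ c),
          GateInterpolates g m ⌈(m : ℝ) ^ δ⌉₊ r s (gammaOf δ m) ((m : ℝ) ^ (-(c : ℝ) - 2))) →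
      LowerBoundAt (fun m => ⌈(m : ℝ) ^ δ⌉₊) := by
  sorry

/-- **Stub 2 — ICL for `∧₂` and `∨₂` in the constant-locality / inverse-polynomial currency (provable
now, S/M-sized; the calibration of the whole line).** `∨₂`: `A = dnf₁ ∪ dnf₂` (no positive error),
`B` = the `(s-1)`-CNF of `monotoneSwitching_dnf A` with `≤ C(r-1,2)^s` exact `s`-clauses of correction,
each inside `E` with probability `γ^s`: error `(C(r-1,2)·γ)^s = (2r² ln m)^s m^{-δ s} ≤ m^{-c-2}` once
`s > (c+2)/δ`. `∧₂`: `B = cnf₁ ∪ cnf₂` (no negative error), `A` = the DNF of `monotoneSwitching_cnf B`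
at edge-depth `r' = ⌊(r-1)/2⌋ + 1` (monomials with `< r'` edges touch `< r` vertices) with `≤ (s-1)^{r'}`
exact `r'`-edge corrections `P`, each inside a uniform `k`-set with probability `≤ (k/m)^{v(P)}`,
`v(P) ≥ √(2r')` vertices: error `≤ (s-1)^{r'} m^{-(1-δ)√(2r') + o(1)} ≤ m^{-c-2}` once
`(1-δ)√(r-1) > c+2`. Needs `δ < 1` (Disproof §1 `not_lowerBoundAt_delta_one`: at `k = m` the `∧`-side
error is 1). Thresholds `r₀, s₀` depend on `c, δ` only; constants are absorbed by `∀ᶠ m`. -/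
theorem stub_andOrInterpolate :
    ∀ δ : ℝ, 0 < δ → δ < 1 → ∀ c : ℕ, ∃ r₀ s₀ : ℕ, ∀ r s : ℕ, r₀ ≤ r → s₀ ≤ s →
      ∀ᶠ m : ℕ in atTop, ∀ g : GateFn, (g = GateFn.and 2 ∨ g = GateFn.or 2) →
        GateInterpolates g m ⌈(m : ℝ) ^ δ⌉₊ r s (gammaOf δ m) ((m : ℝ) ^ (-(c : ℝ) - 2)) := by
  sorry

/-- **Stub 3 — ICL(CONV) (research; the HARDEST stub).** No monotone SDP-feasibility gate
`v ↦ [∃ Y ⪰ 0, tr(Aᵢ Y) ≤ bᵢ + (Bv)ᵢ]`, `B ≥ 0`, `#constraints + dim Y ≤ m^c` (this includes every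
nonnegative threshold / LP-feasibility gate of unbounded fan-in), fed with `r`-local-DNF / `s`-local-CNF
children, is CLIQUE-like at constant scale on the referee pair: its `Φ_D` cannot accept `> m^{-c-2}` of the
bare `k`-cliques through only-large certificates while its `Φ_C` rejects `> m^{-c-2}` of `K_m ∖ G(m,γ)`
without short common breaks. Two-sided, inverse-polynomial-error, single-gate form of ConvexGateBlind (#2)
restricted to the pair; evidence: θ-type SDPs accept the negatives (Coja-Oghlan 2005; sub-mean deviations of
ϑ are `exp(-m^{Ω(δ)})` by vertex-Lipschitz concentration) and degree-`m^{Ω(1)}` SOS cannot refute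
`k`-independent sets in `G(m,γ)` (Jones et al. 2022) — blindness OF METHODS in the typical case; the stub
needs LARGE-DEVIATION blindness (`m^{-c-2}` for every `c`) and arbitrary local children. Realisation-free
(a property of the gate function), so Farkas/certificate localisation (card certificates-on-the-defect)
applies to LP data directly and to SDP data only after a certified re-realisation (Disproof §8). -/
theorem stub_convInterpolates :
    ∀ δ : ℝ, 0 < δ → δ < 1 / 2 → ∀ c : ℕ, ∃ r₀ s₀ : ℕ, ∀ r s : ℕ, r₀ ≤ r → s₀ ≤ s →
      ∀ᶠ m : ℕ in atTop, ∀ g : GateFn, IsConvGate (m ^ c) g →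
        GateInterpolates g m ⌈(m : ℝ) ^ δ⌉₊ r s (gammaOf δ m) ((m : ℝ) ^ (-(c : ℝ) - 2)) := by
  sorry

/-- **Stub 4 — ICL(PERM) (research).** No permutation-group membership gate on `≤ m^c` points
(`τ ∈ ⟨σᵢ : vᵢ = 1⟩`; abelian case = monotone span programs over `ℤ/q` with wire-owned rows, Disproof §7)
over local children is CLIQUE-like at constant scale on the pair. Structure to exploit: for exact edge
children a generating set meets every cut, so the canonical interpolant is (small generating vertex sets,
small cuts) and ICL splits into two ONE-distribution tail bounds — `Pr_K[K generates τ only through ≥ r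
vertices] ≤ ε` and `Pr_E[E ⊇ a cut but no cut of < s edges] ≤ ε`; the dimension bound `d ≤ m^c` is what
must be spent (for `d = permWidth m k` the statement is false: `Negative.exists_onePermGate_extGate_computes`
+ Stub 1). Single-gate content of LinAlgGateBlind (#4) in two-sided distributional form; nearest theorems:
rank-measure / lifting bounds for mSPAN as a whole device (Pitassi–Robere 2018), not yet for a gate reading
AND/OR children. -/
theorem stub_permInterpolates :
    ∀ δ : ℝ, 0 < δ → δ < 1 / 2 → ∀ c : ℕ, ∃ r₀ s₀ : ℕ, ∀ r s : ℕ, r₀ ≤ r → s₀ ≤ s →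
      ∀ᶠ m : ℕ in atTop, ∀ g : GateFn, IsPermGate (m ^ c) g →
        GateInterpolates g m ⌈(m : ℝ) ^ δ⌉₊ r s (gammaOf δ m) ((m : ℝ) ^ (-(c : ℝ) - 2)) := by
  sorry

/-- **Stub 5 — ICL(GRANK) (research).** No generic-rank threshold gate of dimension `≤ m^c` over any
field (`θ ≤ rank_{Frac F[X]} (K₀ + Σ_{vᵢ=1} Xᵢ Kᵢ)`; by `IsGRankGate.eq_true_iff_exists_support` its
acceptance set is the up-closure of the monomial supports of its `θ`-minors, each of `≤ θ ≤ m^c` wires)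
over local children is CLIQUE-like at constant scale on the pair. Staging: rank-1 generators (matroid
intersection, Edmonds) → skew rank-2 (linear matroid parity, Lovász) → general; the obligation of a
GRANK-based kill of the crux itself is Disproof §6 `grank_sees_every_clique`. The only place the statement
exceeds P/poly-evaluable gates is a wild field `F : Type` (non-uniform constants), as in the crux. -/
theorem stub_grankInterpolates :
    ∀ δ : ℝ, 0 < δ → δ < 1 / 2 → ∀ c : ℕ, ∃ r₀ s₀ : ℕ, ∀ r s : ℕ, r₀ ≤ r → s₀ ≤ s →
      ∀ᶠ m : ℕ in atTop, ∀ g : GateFn, IsGRankGate (m ^ c) g →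
        GateInterpolates g m ⌈(m : ℝ) ^ δ⌉₊ r s (gammaOf δ m) ((m : ℝ) ^ (-(c : ℝ) - 2)) := by
  sorry

/-! ### Name-keyed aliases of the five statements (the hypotheses of the composition) -/
namespace Registered

/-- Alias of `SandwichReduction` keyed by the registered stub name. -/
abbrev stub_sandwichReduction : Prop := SandwichReduction
/-- Alias of `AndOrInterpolate` keyed by the registered stub name. -/
abbrev stub_andOrInterpolate : Prop := AndOrInterpolate
/-- Alias of `ConvInterpolates` keyed by the registered stub name. -/
abbrev stub_convInterpolates : Prop := ConvInterpolates
/-- Alias of `PermInterpolates` keyed by the registered stub name. -/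
abbrev stub_permInterpolates : Prop := PermInterpolates
/-- Alias of `GRankInterpolates` keyed by the registered stub name. -/
abbrev stub_grankInterpolates : Prop := GRankInterpolates

end Registered

/-! ### The kernel-checked composition -/

/-- **Composition.** The five stubs imply the crux BY NAME: take `δ = 1/4`; for each `c` a common
locality `(r,s)` above the four thresholds (and `≥ (3,2)`), intersect the four `∀ᶠ m` filters, dispatch a
gate of `extGate (m^c) = {∧₂,∨₂} ∪ CONV ∪ PERM ∪ GRANK` (`mem_extGate_iff`) to its stub, feed Stub 1, and
read the schedule form back into the inline route text (`Negative.cliqueExtLowerBound_iff`, `Iff.rfl` up to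
`inlineExt = extGate`). No `sorry`. -/
theorem CliqueExtLowerBound_of (hRed : Registered.stub_sandwichReduction)
    (hAndOr : Registered.stub_andOrInterpolate) (hConv : Registered.stub_convInterpolates)
    (hPerm : Registered.stub_permInterpolates) (hGRank : Registered.stub_grankInterpolates) :
    Summit.PneNP.PneNP.Theses.ConvexRankGates.CliqueExtLowerBound := by
  rw [cliqueExtLowerBound_iff]
  refine ⟨1 / 4, by norm_num, by norm_num, ?_⟩
  refine hRed (1 / 4) (by norm_num) (by norm_num) fun c => ?_
  obtain ⟨r₁, s₁, h₁⟩ := hAndOr (1 / 4) (by norm_num) (by norm_num) c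
  obtain ⟨r₂, s₂, h₂⟩ := hConv (1 / 4) (by norm_num) (by norm_num) c
  obtain ⟨r₃, s₃, h₃⟩ := hPerm (1 / 4) (by norm_num) (by norm_num) c
  obtain ⟨r₄, s₄, h₄⟩ := hGRank (1 / 4) (by norm_num) (by norm_num) c
  -- one common locality for all four gate classes (explicit maxima, so that the side goals are closed terms)
  refine ⟨max (max (max (max 3 r₁) r₂) r₃) r₄, max (max (max (max 2 s₁) s₂) s₃) s₄,
    by simp only [le_max_iff, le_refl, true_or], by simp only [le_max_iff, le_refl, true_or], ?_⟩
  have e₁ := h₁ (max (max (max (max 3 r₁) r₂) r₃) r₄) (max (max (max (max 2 s₁) s₂) s₃) s₄)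
    (by simp only [le_max_iff, le_refl, true_or, or_true]) (by simp only [le_max_iff, le_refl, true_or, or_true])
  have e₂ := h₂ (max (max (max (max 3 r₁) r₂) r₃) r₄) (max (max (max (max 2 s₁) s₂) s₃) s₄)
    (by simp only [le_max_iff, le_refl, true_or, or_true]) (by simp only [le_max_iff, le_refl, true_or, or_true])
  have e₃ := h₃ (max (max (max (max 3 r₁) r₂) r₃) r₄) (max (max (max (max 2 s₁) s₂) s₃) s₄)
    (by simp only [le_max_iff, le_refl, true_or, or_true]) (by simp only [le_max_iff, le_refl, true_or, or_true])
  have e₄ := h₄ (max (max (max (max 3 r₁) r₂) r₃) r₄) (max (max (max (max 2 s₁) s₂) s₃) s₄)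
    (by simp only [le_max_iff, le_refl, true_or, or_true]) (by simp only [le_max_iff, le_refl, true_or, or_true])
  filter_upwards [e₁, e₂, e₃, e₄] with m hm₁ hm₂ hm₃ hm₄ g hg
  rw [mem_extGate_iff] at hg
  rcases hg with h | h | h | h | h
  · exact hm₁ g (Or.inl h)
  · exact hm₁ g (Or.inr h)
  · exact hm₂ g h
  · exact hm₃ g h
  · exact hm₄ g h

/-- **`CliqueExtLowerBound_closed`** — the same composition as a CLOSED term (the crux modulo the five `stub_*`
sorries): the registered stubs, stated verbatim, are definitionally the named statements and feed
`CliqueExtLowerBound_of`. When all five stubs land, this theorem is the sorry-free proof to propose with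
`--workitem stmt-PneNP-10682`. -/
theorem CliqueExtLowerBound_closed : Summit.PneNP.PneNP.Theses.ConvexRankGates.CliqueExtLowerBound :=
  CliqueExtLowerBound_of stub_sandwichReduction stub_andOrInterpolate stub_convInterpolates
    stub_permInterpolates stub_grankInterpolates

end

end Summit.PneNP.PneNP.Cruxes.CliqueExtLowerBound.EventSandwichInterpolation
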